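/-
Copyright: cell pub-balaban-gaps (YM BLITZ Y1, track G1), seat g1-p2 GEN 11 (unit `pub-balaban-gaps-g1-p2`).  Row (D4) NODE O,
OBJECT ∕ MECHANISM level: the row's first-missing-lemma SHAPE `ExistsUniformAcrossSmall` ((v)⁺) INHABITED ACROSS ANY FAMILY OF TORI from
PER-CUBE GAUGED DATA IN FORM CURRENCY — 106's `acrossSmall_gaugedSchur` with the conjugated Schur budget of the WHOLE remainder (which charges
the gradients' size, k-dependent on a fine carrier: g1-plan-1 GEN 38 (σ′)) REPLACED by 109's form data: the operator in each cube's conjugation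
presented as `A₀ + V₀,□(u) + Σ_μ B_□,μ(u)·D_□,μ`, base coercivity and GRADIENT DOMINATION of `A₀`, a Schur budget of the zeroth-order part and
MULTIPLIER letters only (109's `conjCoercive_of_gradient` on the compressed index).  HONEST FRAMING: model ∕ mechanism; the per-cube data are
hypotheses (111–119 supply them for 59b–66's fine-torus carrier, where the GLOBAL margin `hq` — letters `C_K`, `c_s` — stays k-dependent per (σ));
Bałaban's `Δ^{(k)}(𝐔)` NOT constructed; (D4) NOT discharged (instance 0∕1); NOT BetaPertH, NOT continuum, NOT Clay.
-/
import Summits.QuantumFields.BalabanUV.Gaps.D4WalkModelGaugedSchur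
import Summits.QuantumFields.BalabanUV.Gaps.D4WalkBlockFormCoercive

/-!
# `Gaps.D4WalkModelGaugedGradient` — (v)⁺ across tori from per-cube conjugators and per-cube FORM data (base coercivity, gradient domination,
# zeroth-order Schur budget, multiplier letters) (cell pub-balaban-gaps, seat g1-p2 gen 11)

HONEST DEPENDENCY (cell pub-balaban, verbatim): continuum YM on T⁴ ⇐ BetaPertH ∧ nine spine estimates (0/9 proved); BetaPertH ⇐ (D1) ∧ (D4) ∧ CAP+tail.

* **`acrossSmall_gaugedGradient`** — `ExistsUniformAcrossSmall` for the parametrix model across ANY family of tori from: per member and cube a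
  mutually inverse `□̃`-reducing cube-local conjugator pair, the presentation `G_□(1 + K′(u))G_□′ = A₀ + V₀,□(u) + Σ_μ B_□,μ(u)·D_□,μ` on the ball,
  `A₀` conjugated-coercive `m` and dominating the conjugated gradients `(γ, c_D)` along every column weight, Schur sums `a_r, a_c` of
  `compress V₀,□(u) □̃`, multipliers reducing `□̃` with letters `β_r(μ), β_c`, `0 < t`, `tβ_cγ ≤ 2`, `0 < m′ ≤` the form margin; `C_L = r_gr_g′c_s∕m′`;
  proof = 106's `acrossSmall_parametrix` route with the per-cube coercivity from 109 (`compress_presented`, `conjCoercive_of_gradient`,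
  `gradDom_compress`, the β cell's `conjCoercive_compress`, GEN 5's `re_conjForm_ge_neg_schur`).
WHAT IT IS NOT.  The instance (59b–66's carrier: 111–119; Bałaban's terms: OBJECT level); words of row (D4) UNCHANGED (`ExistsUniformAcrossSmall
𝓣_Bałaban α Rσ₀ θ₀` + `TermDomination`, OBJECT level); (D4) instance 0∕1.

References (method only): T. Bałaban, Comm. Math. Phys. **99** (1985) 389–434 [B9]; Comm. Math. Phys. **116** (1988) [II].
-/

noncomputable section

namespace Summit.QuantumFields.BalabanUV.Gaps.D4WalkModelGaugedGradient

open Metric Set Finset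
open scoped Matrix BigOperators
open Literature.MathematicalPhysics.QuantumFieldTheory.Balaban1983to89
open Literature.MathematicalPhysics.QuantumFieldTheory.Balaban1983to89.B9Thm34Ext (toB6)
open Literature.MathematicalPhysics.QuantumFieldTheory.Balaban1983to89.B9Thm37GlueTorus (torusGeom tdist1)
open Literature.MathematicalPhysics.QuantumFieldTheory.Balaban1983to89.B5TorusCover (UT)
open Literature.MathematicalPhysics.QuantumFieldTheory.Balaban1983to89.B11SectG (RowSum)
open Literature.MathematicalPhysics.QuantumFieldTheory.Balaban1983to89.B5Prop11Lower (nsq nsq_nonneg)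
open Literature.MathematicalPhysics.QuantumFieldTheory.Balaban1983to89.B13TermWalkDataOneTorus (ExistsUniformAcrossSmall)
open Summit.QuantumFields.BalabanUV.Gaps.D4WalkBlock (blockNorm blockNorm_nonneg)
open Summit.QuantumFields.BalabanUV.Gaps.D4WalkModelParametrix (ParametrixModelMember acrossSmall_parametrix)
open Summit.QuantumFields.BalabanUV.Gaps.D4WalkBlockCommutator (blockNorm_comm_le comm_blocks_subset)
open Summit.QuantumFields.BalabanUV.Gaps.D4WalkBlockLocalInverse (cRow cCol re_conjForm_ge_neg_schur)
open Summit.QuantumFields.BalabanUV.Gaps.D4WalkModelGaugedSchur (differentiableOn_locInv_reducing blockNorm_locInv_reducing_le)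
open Summit.QuantumFields.BalabanUV.Gaps.D4WalkBlockFormCoercive (conjCoercive_of_gradient compress_presented gradDom_compress)
open Summit.QuantumFields.BalabanUV.Beta.UnitLatticeLocalInverse (compress extend conjCoercive_compress)
open Summit.QuantumFields.BalabanUV.Beta.UnitLatticeNearFar (compress_add)
open Summit.QuantumFields.BalabanUV.Beta.AccretiveCombesThomas (conjForm)
open Summit.QuantumFields.BalabanUV.T4Continuum.CTWeightedCoercivity (conjMat)

variable {d : ℕ} {c : B13.Consts}

/-- **(v)⁺ ACROSS A FAMILY OF TORI FROM PER-CUBE GAUGED FORM DATA** — 106's `acrossSmall_gaugedSchur` with the per-cube SCHUR budget of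
the whole remainder REPLACED by the FORM-currency data of `D4WalkBlockFormCoercive`: for every member and cube `□`, the operator in `□`'s
conjugation PRESENTED as `G_□(1 + K′(u))G_□′ = A₀ + V₀,□(u) + Σ_μ B_□,μ(u)·D_□,μ`, base conjugated coercivity `m` and gradient domination
`(γ, c_D)` of `A₀` along every column weight, Schur sums `≤ a_r, a_c` of `compress V₀,□(u) □̃`, multipliers reducing `□̃` with conjugated row ∕ column
letters `β_r(μ), β_c` ON `□̃`, and any `0 < m′ ≤ (1 − tβ_cγ∕2)m − ½(a_r + a_c) − Σ_μβ_r(μ)∕(2t) − tβ_c c_D∕2`; `C_L = r_gr_g′·c_s∕m′`.  The gradients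
`D_□,μ` carry NO letter.  Every other letter as in `acrossSmall_gaugedSchur`. [cite: Balaban1985BackgroundPropagators, (3.35) p.396, Thms 3.1–3.3 (3.42) p.399, (3.52)–(3.54) pp.400–401, Cor 3.6 p.408, Thm 3.7 p.409, Cor 3.8 p.410, Thm 3.10 p.416; Balaban1988RG2Cluster, (1.11) p.5, p.13, p.15, (2.16) p.16] -/
theorem acrossSmall_gaugedGradient {S : Type*} {μs : Type*} [Fintype μs] (𝓜 : S → ParametrixModelMember d)
    (ds : ∀ s (i : (𝓜 s).ι), ((𝓜 s).t i).n → ((𝓜 s).t i).n → ℝ)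
    (Gc Gc' : ∀ s (i : (𝓜 s).ι), ((𝓜 s).t i).L.B → Matrix ((𝓜 s).t i).n ((𝓜 s).t i).n ℂ)
    (A₀ : ∀ s (i : (𝓜 s).ι), Matrix ((𝓜 s).t i).n ((𝓜 s).t i).n ℂ)
    (V₀ : ∀ s (i : (𝓜 s).ι), ((𝓜 s).t i).L.B → (𝓜 s).E → Matrix ((𝓜 s).t i).n ((𝓜 s).t i).n ℂ)
    (Bm : ∀ s (i : (𝓜 s).ι), ((𝓜 s).t i).L.B → μs → (𝓜 s).E → Matrix ((𝓜 s).t i).n ((𝓜 s).t i).n ℂ)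
    (Dg : ∀ s (i : (𝓜 s).ι), ((𝓜 s).t i).L.B → μs → Matrix ((𝓜 s).t i).n ((𝓜 s).t i).n ℂ)
    {R CK M m m' γ cD ar ac βc t κc cs r₁ r rg rg' : ℝ} {βr : μs → ℝ} {mJ nD nC : ℕ} {ρ₀ ε₀ κ₀ μ cμ Rσ₀ α θ₀ : ℝ}
    (hop : ∀ s (i : (𝓜 s).ι) b u,
      ((𝓜 s).t i).L.op b u = extend (compress (1 + ((𝓜 s).t i).K' u) (((𝓜 s).t i).Es b))⁻¹)
    (hanchor : ∀ s (i : (𝓜 s).ι) b, ((𝓜 s).t i).L.anchor b ∈ ((𝓜 s).t i).L.dom b)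
    (hdiam : ∀ s (i : (𝓜 s).ι) b, ∀ z ∈ ((𝓜 s).t i).L.dom b, ∀ z' ∈ ((𝓜 s).t i).L.dom b, tdist1 (𝓜 s).K z z' ≤ r)
    (hJ : ∀ s (i : (𝓜 s).ι) b, (((𝓜 s).t i).L.J b).card ≤ mJ)
    (hX : ∀ s (i : (𝓜 s).ι) b, (((𝓜 s).t i).L.J b).Nonempty → (((𝓜 s).t i).L.dom b ∩ ((𝓜 s).t i).X).Nonempty)
    (hmult : ∀ s (i : (𝓜 s).ι) (z : UT (𝓜 s).K), (Finset.univ.filter fun b => ((𝓜 s).t i).L.anchor b = z).card ≤ nD)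
    (hcard : ∀ s (i : (𝓜 s).ι) b, (((𝓜 s).t i).L.dom b).card ≤ nC)
    (hsupp : ∀ s (i : (𝓜 s).ι) b y, y ∉ ((𝓜 s).t i).Es b → ((𝓜 s).t i).h b y = 0)
    (habs : ∀ s (i : (𝓜 s).ι) b y, |((𝓜 s).t i).h b y| ≤ 1)
    (hE : ∀ s (i : (𝓜 s).ι) b y, y ∈ ((𝓜 s).t i).Es b → ((𝓜 s).t i).cubn y ∈ ((𝓜 s).t i).L.dom b)
    (hLip : ∀ s (i : (𝓜 s).ι) b k l, |((𝓜 s).t i).h b k - ((𝓜 s).t i).h b l| ≤ ds s i k l / M)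
    (hdomE : ∀ s (i : (𝓜 s).ι) b k, (∃ l ∈ ((𝓜 s).t i).Es b, ds s i k l ≤ r₁) → ((𝓜 s).t i).cubn k ∈ ((𝓜 s).t i).L.dom b)
    (hsymm : ∀ s (i : (𝓜 s).ι) k l, ds s i k l = ds s i l k) (hd0 : ∀ s (i : (𝓜 s).ι) l, ds s i l l = 0)
    (hKan : ∀ s (i : (𝓜 s).ι) k l, DifferentiableOn ℂ (fun u => ((𝓜 s).t i).K' u k l) (ball (0 : (𝓜 s).E) R))
    (hKbd : ∀ s (i : (𝓜 s).ι), ∀ u ∈ ball (0 : (𝓜 s).E) R, ∀ y y',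
      blockNorm ((𝓜 s).t i).cubn ((𝓜 s).t i).cubn (((𝓜 s).t i).K' u) y y' ≤ CK)
    (hKrange : ∀ s (i : (𝓜 s).ι) u k l, ((𝓜 s).t i).K' u k l ≠ 0 → ds s i k l ≤ r₁)
    -- per-cube conjugators (gauges), base coercivity, Schur budgets
    (hGred : ∀ s (i : (𝓜 s).ι) b k l, Gc s i b k l ≠ 0 → (k ∈ ((𝓜 s).t i).Es b ↔ l ∈ ((𝓜 s).t i).Es b))
    (hG'red : ∀ s (i : (𝓜 s).ι) b k l, Gc' s i b k l ≠ 0 → (k ∈ ((𝓜 s).t i).Es b ↔ l ∈ ((𝓜 s).t i).Es b))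
    (hGG' : ∀ s (i : (𝓜 s).ι) b, Gc s i b * Gc' s i b = 1) (hG'G : ∀ s (i : (𝓜 s).ι) b, Gc' s i b * Gc s i b = 1)
    (hGloc : ∀ s (i : (𝓜 s).ι) b k l, ((𝓜 s).t i).cubn k ≠ ((𝓜 s).t i).cubn l → Gc s i b k l = 0)
    (hG'loc : ∀ s (i : (𝓜 s).ι) b k l, ((𝓜 s).t i).cubn k ≠ ((𝓜 s).t i).cubn l → Gc' s i b k l = 0)
    (hrg0 : 0 ≤ rg) (hrg0' : 0 ≤ rg')
    (hrg : ∀ s (i : (𝓜 s).ι) b k, ∑ l, ‖Gc' s i b k l‖ ≤ rg) (hrg' : ∀ s (i : (𝓜 s).ι) b k, ∑ l, ‖Gc s i b k l‖ ≤ rg')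
    (hcov : ∀ s (i : (𝓜 s).ι) b, ∀ u ∈ ball (0 : (𝓜 s).E) R,
      Gc s i b * (1 + ((𝓜 s).t i).K' u) * Gc' s i b = A₀ s i + V₀ s i b u + ∑ μ, Bm s i b μ u * Dg s i b μ)
    (h0 : ∀ s (i : (𝓜 s).ι) b, ∀ j : ((𝓜 s).t i).Es b, ∀ z : ((𝓜 s).t i).n → ℂ,
      m * nsq z ≤ (conjForm (A₀ s i) κc (fun e => ds s i e j) z).re)
    (hD : ∀ s (i : (𝓜 s).ι) b, ∀ j : ((𝓜 s).t i).Es b, ∀ z : ((𝓜 s).t i).n → ℂ,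
      ∑ μ, nsq (conjMat κc (fun e => ds s i e j) (fun e => ds s i e j) (Dg s i b μ) *ᵥ z)
        ≤ γ * (conjForm (A₀ s i) κc (fun e => ds s i e j) z).re + cD * nsq z)
    (hVr : ∀ s (i : (𝓜 s).ι) b, ∀ u ∈ ball (0 : (𝓜 s).E) R, ∀ (j : ((𝓜 s).t i).Es b) (e : ((𝓜 s).t i).Es b),
      cRow (compress (V₀ s i b u) (((𝓜 s).t i).Es b)) κc (fun e : ((𝓜 s).t i).Es b => ds s i e j) e ≤ ar)
    (hVc : ∀ s (i : (𝓜 s).ι) b, ∀ u ∈ ball (0 : (𝓜 s).E) R, ∀ (j : ((𝓜 s).t i).Es b) (e' : ((𝓜 s).t i).Es b),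
      cCol (compress (V₀ s i b u) (((𝓜 s).t i).Es b)) κc (fun e : ((𝓜 s).t i).Es b => ds s i e j) e' ≤ ac)
    (hBS : ∀ s (i : (𝓜 s).ι) b μ u k l, Bm s i b μ u k l ≠ 0 → (k ∈ ((𝓜 s).t i).Es b ↔ l ∈ ((𝓜 s).t i).Es b))
    (hBr : ∀ s (i : (𝓜 s).ι) b, ∀ u ∈ ball (0 : (𝓜 s).E) R, ∀ μ (j : ((𝓜 s).t i).Es b) (e : ((𝓜 s).t i).Es b),
      cRow (compress (Bm s i b μ u) (((𝓜 s).t i).Es b)) κc (fun e : ((𝓜 s).t i).Es b => ds s i e j) e ≤ βr μ)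
    (hBc : ∀ s (i : (𝓜 s).ι) b, ∀ u ∈ ball (0 : (𝓜 s).E) R, ∀ μ (j : ((𝓜 s).t i).Es b) (e' : ((𝓜 s).t i).Es b),
      cCol (compress (Bm s i b μ u) (((𝓜 s).t i).Es b)) κc (fun e : ((𝓜 s).t i).Es b => ds s i e j) e' ≤ βc)
    (ht : 0 < t) (hβc : 0 ≤ βc) (htγ : t * βc * γ ≤ 2) (hmS : 0 < m')
    (hmargin : m' ≤ (1 - t * βc * γ / 2) * m - (ar + ac) / 2 - (∑ μ, βr μ) / (2 * t) - t * βc * cD / 2)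
    (hsite : ∀ s (i : (𝓜 s).ι) k, ∑ l, Real.exp (-(κc * ds s i k l)) ≤ cs)
    (hrow : ∀ s, RowSum (toB6 (torusGeom (𝓜 s).K 0 0 0) 0 True) μ cμ)
    (hfar : ∀ s (i : (𝓜 s).ι) (b : ((𝓜 s).t i).Λ), ∀ z ∈ ((𝓜 s).t i).X,
      Rσ₀ ≤ tdist1 (𝓜 s).K (((𝓜 s).t i).cubn (((𝓜 s).t i).rowOf b)) z)
    (hκ₁ : 0 ≤ c.κ₁) (hCK : 0 ≤ CK) (hM : 0 < M) (hκc : 0 ≤ κc) (hcs : 0 ≤ cs) (hr₁ : 0 ≤ r₁)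
    (hμ : 0 ≤ μ) (hμε : 3 * μ ≤ ε₀) (hμκ : 2 * μ < κ₀) (hwin : κ₀ + μ ≤ ρ₀ - ε₀) (hcμ : 0 ≤ cμ)
    (hq : cμ * (cμ * 1 *
      (1 * (((nC * (r₁ / M * CK) * (rg * rg' * (cs / m'))) * Real.exp (c.κ₁ * mJ) * Real.exp (2 * ρ₀ * r)) *
        Real.exp (μ * r) * (nD * cμ))) * cμ) * cμ < 1)
    (hα : 0 ≤ α) (hαR : α < R)
    (hθ : 2 * max (cμ * (((rg * rg' * (cs / m')) * Real.exp (c.κ₁ * mJ) * Real.exp (2 * ρ₀ * r)) *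
          Real.exp (μ * r) * (nD * cμ)) *
          (1 * (1 - cμ * (cμ * 1 *
            (1 * (((nC * (r₁ / M * CK) * (rg * rg' * (cs / m'))) * Real.exp (c.κ₁ * mJ) *
              Real.exp (2 * ρ₀ * r)) * Real.exp (μ * r) * (nD * cμ))) * cμ) * cμ)⁻¹) * cμ) 1
        * (Real.exp (-((ε₀ - 3 * μ) * Rσ₀)) + α / R) ≤ θ₀) :
    ExistsUniformAcrossSmall (fun s => (𝓜 s).toTorusTerms c) α Rσ₀ θ₀ := by
  -- per-cube coercivity of the conjugated compression, FORM currency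
  have hS : ∀ s (i : (𝓜 s).ι) b, ∀ u ∈ ball (0 : (𝓜 s).E) R, ∀ j : ((𝓜 s).t i).Es b, ∀ z : ((𝓜 s).t i).Es b → ℂ,
      m' * nsq z ≤ (conjForm (compress (Gc s i b * (1 + ((𝓜 s).t i).K' u) * Gc' s i b) (((𝓜 s).t i).Es b)) κc
        (fun e : ((𝓜 s).t i).Es b => ds s i e j) z).re := by
    intro s i b u hu j z
    refine le_trans (mul_le_mul_of_nonneg_right hmargin (nsq_nonneg z)) ?_
    rw [hcov s i b u hu, add_assoc, compress_add, compress_presented (V₀ s i b u) (fun μ => Bm s i b μ u) (Dg s i b) _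
      (fun μ => hBS s i b μ u), ← add_assoc]
    exact conjCoercive_of_gradient (compress (A₀ s i) _) (compress (V₀ s i b u) _) (fun μ => compress (Bm s i b μ u) _)
      (fun μ => compress (Dg s i b μ) _) κc (fun e : ((𝓜 s).t i).Es b => ds s i e j)
      (conjCoercive_compress (A₀ s i) κc (fun e => ds s i e j) (h0 s i b j))
      (gradDom_compress (A₀ s i) (Dg s i b) _ κc (fun e => ds s i e j) (hD s i b j))
      (re_conjForm_ge_neg_schur _ κc _ (hVr s i b u hu j) (hVc s i b u hu j))
      (fun μ e => hBr s i b u hu μ j e) (fun μ e' => hBc s i b u hu μ j e') ht hβc htγ z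
  have ha : ∀ s (i : (𝓜 s).ι) k l, DifferentiableOn ℂ (fun u => (1 + ((𝓜 s).t i).K' u) k l) (ball (0 : (𝓜 s).E) R) :=
    fun s i k l => by simp only [Matrix.add_apply]; exact (differentiableOn_const _).add (hKan s i k l)
  exact acrossSmall_parametrix 𝓜 hanchor hdiam hJ hX hmult hsupp habs hE
    (fun s i b k l => by
      have e : (fun u => ((𝓜 s).t i).L.op b u k l) =
          fun u => extend (compress (1 + ((𝓜 s).t i).K' u) (((𝓜 s).t i).Es b))⁻¹ k l := funext fun u => by rw [hop]
      rw [e]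
      exact differentiableOn_locInv_reducing (hGred s i b) (hG'red s i b) (hGG' s i b) (hG'G s i b) (ds s i) hmS (ha s i)
        (hS s i b) k l)
    (fun s i b u hu y y' => by
      rw [hop s i b u]
      exact blockNorm_locInv_reducing_le ((𝓜 s).t i).cubn (hGred s i b) (hG'red s i b) (hGG' s i b) (hG'G s i b) (hGloc s i b)
        (hG'loc s i b) hrg0 hrg0' (hrg s i b) (hrg' s i b) (1 + ((𝓜 s).t i).K' u) (ds s i) (hd0 s i) hκc hmS (hS s i b u hu) hcs
        (hsite s i) y y')
    hKan
    (fun s i b u hu y y' => (blockNorm_comm_le ((𝓜 s).t i).cubn ((𝓜 s).t i).h (ds s i) hM hr₁ (hLip s i)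
      (((𝓜 s).t i).K' u) (hKrange s i u) b y y').trans (mul_le_mul_of_nonneg_left (hKbd s i u hu y y') (div_nonneg hr₁ hM.le)))
    (fun s i b u y y' hne => comm_blocks_subset ((𝓜 s).t i).cubn ((𝓜 s).t i).h ((𝓜 s).t i).Es (hsupp s i) (ds s i)
      (hsymm s i) (fun l => by rw [hd0 s i]; exact hr₁) (((𝓜 s).t i).K' u) (hKrange s i u) ((𝓜 s).t i).L.dom (hdomE s i)
      b y y' hne)
    hcard hrow hfar hκ₁ (mul_nonneg (mul_nonneg hrg0 hrg0') (div_nonneg hcs hmS.le)) (mul_nonneg (div_nonneg hr₁ hM.le) hCK)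
    hμ hμε hμκ hwin hcμ hq hα hαR hθ

end Summit.QuantumFields.BalabanUV.Gaps.D4WalkModelGaugedGradient

end
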